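import Literature.Topology.FourManifolds.HomotopySpheresBP
import Literature.Topology.FourManifolds.OpenCollarExistence
import Literature.Topology.FourManifolds.GluingConstructionBoundary
import Literature.Topology.FourManifolds.ClosedAsCobordism
import Literature.Topology.FourManifolds.NeckCapping
import Literature.Topology.FourManifolds.RotationBody
import Mathlib.Topology.Homeomorph.Lemmas
import HarnessLib

/-!
# Filling in a disc: a cobordism to the sphere, capped off by `𝔻ⁿ⁺¹`, is a null-cobordism (Kervaire–Milnor, proof of Lemma 2.3)

Topic `Literature/Topology/FourManifolds`. Kervaire–Milnor, *Groups of homotopy spheres I*,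
Ann. of Math. 77 (1963), proof of Lemma 2.3 (p. 506): "If `M + (-Sⁿ) = bW` then filling in a disk
`Dⁿ⁺¹` we obtain a manifold `W'` with `bW' = M`." This file carries out this construction for the
tree's `Literature.Topology.FourManifolds.Cobordism` / `Literature.Topology.FourManifolds.NullCobordism`
(the smooth half of the direction `⇒` of Kervaire–Milnor's Lemma 2.3, named fact
`Literature.Topology.FourManifolds.boundsContractible_of_isHCobordant_sphere` of
`HomotopySpheresInverse.lean`); it is the mirror image of `BallRemovalCobordism.lean` (removing an
open ball from a null-cobordism), whose layout it follows.

## Construction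

Let `(W; M, 𝕊ⁿ)` be a cobordism (`d : Cobordism n M (𝕊 n)`, ends `d.inl : M → W`,
`d.inr : 𝕊ⁿ → W`) and let `D` be a long open collar `∂W × [0, ∞) → W` of the boundary of `W`
(`Literature.Topology.FourManifolds.BoundaryData.OpenCollar`, which exists on every compact manifold
with boundary, `BoundaryData.nonempty_openCollar`); write `κ (y, t) = D (d.inr y, t)` for the collar
of the sphere end. The capped manifold `W' = W ∪_{𝕊ⁿ} 𝔻ⁿ⁺¹` is assembled, as a `C^∞` manifold with
boundary, by the tree's gluing of manifolds with boundary (`GluingConstructionBoundary.lean`) from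

* the open submanifold `A = W ∖ d.inr (𝕊ⁿ)` of `W` (the sphere end removed), and
* Euclidean space `B = ℝⁿ⁺¹`, re-charted on the half-space model (`HalfSpaceCharted`,
  `ClosedAsCobordism.lean`; no boundary),

glued along `κ (y, t) ↦ (1 + t) y` (`t > 0`), a diffeomorphism of the open collar
`κ (𝕊ⁿ × (0, ∞)) ⊆ A` onto the exterior `{1 < ‖x‖} ⊆ B` of the closed unit ball, with inverse
`x ↦ κ (x/‖x‖, ‖x‖ - 1)`. In the glued manifold `V` the closed unit ball of `B` is the disc that has
been filled in, and its boundary sphere `{‖x‖ = 1}` is where `d.inr (𝕊ⁿ)` used to be. `V` is compact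
Hausdorff and second countable, its boundary is `d.inl (M)` (`FillingData.boundary_V_eq`), and
`inl ∘ d.inl : M → V` is a smooth embedding onto `∂V`: this is the null-cobordism `M = ∂V`
(`FillingData.nullCobordism`). The topological facts needed to see that `V` is contractible when
`(W; M, 𝕊ⁿ)` is an h-cobordism (the embedding `W → V`, `FillingData.embW`, onto the complement of
the open unit ball, and the description of `V` as `W ∪ 𝔻ⁿ⁺¹`) are recorded at the end; the
homotopy theory is in `HomotopySpheresInverseFillingProofs.lean`.

## Main definitions and results (all proved; no named facts)

* `HalfSpaceCharted.contMDiff_of`, `HalfSpaceCharted.contMDiff_of_symm`: the identity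
  `X ≅ HalfSpaceCharted X` is smooth in both directions (complements `ClosedAsCobordism.lean`).
* `Literature.Topology.FourManifolds.FillingData n M`: a cobordism `(W; M, 𝕊ⁿ)` with a long open
  collar of `∂W`; `nonempty_fillingData`.
* `FillingData.glueData`, `FillingData.V` (the capped manifold), instances `T2Space`,
  `CompactSpace`, `SecondCountableTopology`; `FillingData.boundary_V_eq`;
  `FillingData.nullCobordism : NullCobordism n M`, `nullCobordism_W : _ = V`.
* `FillingData.inrE : ℝⁿ⁺¹ → V` (the second piece), `FillingData.embW : W → V` (continuous,
  injective, `embW ∘ d.inr = inrE` on the unit sphere, range `= V ∖ inrE (ball 0 1)`),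
  `FillingData.inl_eq_inrE` (the gluing relation), `FillingData.exists_eq_inrE_or_eq_embW`.

## References

* M. Kervaire, J. Milnor, *Groups of homotopy spheres I*, Ann. of Math. (2) 77 (1963), 504–537,
  proof of Lemma 2.3 (p. 506). doi:10.2307/1970128 [KervaireMilnorAnnals1963]
* J. Milnor, *Lectures on the h-cobordism theorem*, Princeton (1965), §1 (Thm. 1.4: gluing along
  boundary components, via collars). [MilnorHCobordism1965]
-/

open scoped Manifold ContDiff Topology
open Set Function Metric

noncomputable section

universe u

namespace Literature.Topology.FourManifolds

/-- Local notation: `𝔼 n` is the model Euclidean space `EuclideanSpace ℝ (Fin n)`. -/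
local notation "𝔼 " n:arg => EuclideanSpace ℝ (Fin n)
/-- Local notation: `ℍ n` is the model half-space `EuclideanHalfSpace n`. -/
local notation "ℍ " n:arg => EuclideanHalfSpace n
/-- Local notation: `𝕊 n` is the unit sphere in `EuclideanSpace ℝ (Fin (n + 1))`. -/
local notation "𝕊 " n:arg => (Metric.sphere (0 : EuclideanSpace ℝ (Fin (n + 1))) 1)

/-! ### The identity `X ≅ HalfSpaceCharted X` is a diffeomorphism -/

namespace HalfSpaceCharted

variable {n : ℕ} {X : Type u} [TopologicalSpace X] [ChartedSpace (𝔼 (n + 1)) X]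

/-- **`of : X → HalfSpaceCharted X` is smooth** (models `𝓡 (n + 1)`, `𝓡∂ (n + 1)`): in the
extended charts at `p` and `of p` it reads `expFirst` near the base point. [folklore] -/
theorem contMDiffAt_of (p : X) :
    ContMDiffAt (𝓡 (n + 1)) (𝓡∂ (n + 1)) ∞ (of : X → HalfSpaceCharted X) p := by
  rw [_root_.contMDiffAt_iff]
  refine ⟨continuousAt_id, ?_⟩
  simp only [ModelWithCorners.Boundaryless.range_eq_univ (I := 𝓡 (n + 1)), contDiffWithinAt_univ]
  have hev : (extChartAt (𝓡∂ (n + 1)) (of p) ∘ (of : X → HalfSpaceCharted X) ∘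
      (extChartAt (𝓡 (n + 1)) p).symm) =ᶠ[𝓝 (extChartAt (𝓡 (n + 1)) p p)] expFirst n := by
    filter_upwards [extChartAt_target_mem_nhds (I := 𝓡 (n + 1)) p] with u hu
    simp only [comp_apply]
    rw [extChartAt_apply, (extChartAt (𝓡 (n + 1)) p).right_inv hu]
  exact ((contDiff_expFirst n).contDiffAt).congr_of_eventuallyEq hev

/-- `of : X → HalfSpaceCharted X` is smooth. [folklore] -/
theorem contMDiff_of : ContMDiff (𝓡 (n + 1)) (𝓡∂ (n + 1)) ∞ (of : X → HalfSpaceCharted X) :=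
  fun p => contMDiffAt_of p

/-- **`of.symm : HalfSpaceCharted X → X` is smooth**: in the extended charts at `of p` and `p` it
reads `logFirst` near the base point, which lies in the open half-space. [folklore] -/
theorem contMDiffAt_of_symm (p : X) :
    ContMDiffAt (𝓡∂ (n + 1)) (𝓡 (n + 1)) ∞ (of.symm : HalfSpaceCharted X → X) (of p) := by
  rw [_root_.contMDiffAt_iff]
  refine ⟨continuousAt_id, ?_⟩
  have hev := comp_extChartAt_symm_eventuallyEq (n := n) (extChartAt (𝓡 (n + 1)) p) p
  have hlog : ContDiffAt ℝ ∞ (logFirst n) (extChartAt (𝓡∂ (n + 1)) (of p) (of p)) :=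
    contDiffAt_logFirst n (extChartAt_apply_zero_pos p p).ne'
  have hid : (extChartAt (𝓡 (n + 1)) p ∘ (extChartAt (𝓡 (n + 1)) p).symm) =ᶠ[𝓝
      (logFirst n (extChartAt (𝓡∂ (n + 1)) (of p) (of p)))] id := by
    rw [logFirst_extChartAt]
    filter_upwards [extChartAt_target_mem_nhds (I := 𝓡 (n + 1)) p] with u hu
    exact (extChartAt (𝓡 (n + 1)) p).right_inv hu
  have h1 : ContDiffAt ℝ ∞ ((extChartAt (𝓡 (n + 1)) p ∘ (extChartAt (𝓡 (n + 1)) p).symm) ∘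
      logFirst n) (extChartAt (𝓡∂ (n + 1)) (of p) (of p)) :=
    (contDiffAt_id.congr_of_eventuallyEq hid).comp _ hlog
  exact (h1.congr_of_eventuallyEq hev).contDiffWithinAt

/-- `of.symm : HalfSpaceCharted X → X` is smooth. [folklore] -/
theorem contMDiff_of_symm :
    ContMDiff (𝓡∂ (n + 1)) (𝓡 (n + 1)) ∞ (of.symm : HalfSpaceCharted X → X) :=
  fun q => contMDiffAt_of_symm (n := n) (of.symm q)

omit [ChartedSpace (𝔼 (n + 1)) X] in
/-- The identity `X ≅ HalfSpaceCharted X` as a homeomorphism (the synonym carries the topology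
of `X`). [folklore] -/
def ofHomeomorph : X ≃ₜ HalfSpaceCharted X where
  toEquiv := of
  continuous_toFun := continuous_id
  continuous_invFun := continuous_id

omit [ChartedSpace (𝔼 (n + 1)) X] in
/-- `ofHomeomorph` is `of` as a function (definitional). [folklore] -/
@[simp] theorem coe_ofHomeomorph : ⇑(ofHomeomorph : X ≃ₜ HalfSpaceCharted X) = of := rfl

end HalfSpaceCharted

/-! ### Small additions to the normalisation onto the sphere of `RotationBody.lean` -/

namespace DiscFilling

variable {m : ℕ}

/-- A unit vector is nonzero. [folklore] -/
theorem coe_sphere_ne_zero (w : 𝕊 m) : (w : 𝔼 (m + 1)) ≠ 0 := by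
  intro h
  have hw : ‖(w : 𝔼 (m + 1))‖ = 1 := by simp
  rw [h, norm_zero] at hw
  exact zero_ne_one hw

/-- The base point `e₀` of the sphere. [folklore] -/
def pt₀ : 𝕊 m := ⟨EuclideanSpace.single 0 1, by simp⟩

end DiscFilling

open DiscFilling
open RotationBody (sphN coe_sphN sphN_smul sphN_coe norm_smul_coe_sphN contMDiffOn_sphN continuousOn_sphN)

/-! ### Filling data: a cobordism to the sphere with a long open collar of its boundary -/

/-- **Filling data**: a cobordism `(W; M, 𝕊ⁿ)` (tree structure `Cobordism n M (𝕊 n)`) together with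
a long open collar of the boundary `∂W` (tree structure `BoundaryData.OpenCollar` for the boundary
datum `BoundaryManifold.boundaryData n W` carried by the subtype `∂W`). Such a collar exists
because `W` is compact (`nonempty_fillingData`). This is the input of "filling in a disk `Dⁿ⁺¹`"
(Kervaire–Milnor 1963, proof of Lemma 2.3, p. 506). `M : Type`, as the ends of a cobordism share a
universe with `𝕊ⁿ : Type`. [cite: KervaireMilnorAnnals1963, Lemma 2.3, proof (p. 506)] -/
structure FillingData (n : ℕ) (M : Type) [TopologicalSpace M] [ChartedSpace (𝔼 n) M] where
  /-- The cobordism `(W; M, 𝕊ⁿ)` to be capped off. -/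
  cob : Cobordism n M (𝕊 n)
  /-- A long open collar of `∂W`. -/
  collar : (BoundaryManifold.boundaryData n cob.W).OpenCollar

/-- **Filling data exist for every cobordism to the sphere**: the boundary of the compact
manifold `W` has a long open collar (`BoundaryData.nonempty_openCollar`, Milnor 1965, proof of
Thm. 3.4 / Bröcker–Jänich (13.6)). [folklore] -/
theorem nonempty_fillingData {n : ℕ} {M : Type} [TopologicalSpace M] [ChartedSpace (𝔼 n) M]
    (d : Cobordism n M (𝕊 n)) : Nonempty (FillingData n M) := by
  haveI : Nonempty (BoundaryManifold.boundaryData n d.W).carrier :=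
    ⟨(⟨d.inr pt₀, d.inr_mem_boundary pt₀⟩ : (𝓡∂ (n + 1)).boundary d.W)⟩
  obtain ⟨D⟩ := (BoundaryManifold.boundaryData n d.W).nonempty_openCollar
  exact ⟨⟨d, D⟩⟩

/-- Every cobordism to the sphere is the cobordism of some filling data. [folklore] -/
theorem exists_fillingData {n : ℕ} {M : Type} [TopologicalSpace M] [ChartedSpace (𝔼 n) M]
    (d : Cobordism n M (𝕊 n)) : ∃ F : FillingData n M, F.cob = d := by
  haveI : Nonempty (BoundaryManifold.boundaryData n d.W).carrier :=
    ⟨(⟨d.inr pt₀, d.inr_mem_boundary pt₀⟩ : (𝓡∂ (n + 1)).boundary d.W)⟩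
  obtain ⟨D⟩ := (BoundaryManifold.boundaryData n d.W).nonempty_openCollar
  exact ⟨⟨d, D⟩, rfl⟩

namespace FillingData

variable {n : ℕ} {M : Type} [TopologicalSpace M] [ChartedSpace (𝔼 n) M] (F : FillingData n M)

/-! ### The collar of the sphere end -/

/-- The sphere end as a map into the boundary manifold `∂W`. [folklore] -/
def ι (y : 𝕊 n) : (𝓡∂ (n + 1)).boundary F.cob.W := ⟨F.cob.inr y, F.cob.inr_mem_boundary y⟩

/-- The underlying point of `ι y` is `inr y` (definitional). [folklore] -/
@[simp] theorem coe_ι (y : 𝕊 n) : (F.ι y : F.cob.W) = F.cob.inr y := rfl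

/-- `ι` is injective. [folklore] -/
theorem injective_ι : Injective F.ι := fun _ _ h =>
  F.cob.isSmoothEmbedding_inr.isEmbedding.injective (congrArg Subtype.val h)

/-- `ι` is continuous. [folklore] -/
theorem continuous_ι : Continuous F.ι := F.cob.continuous_inr.subtype_mk _

/-- **`ι : 𝕊ⁿ → ∂W` is smooth**: `Subtype.val ∘ ι = inr` is smooth and `∂W ↪ W` is an immersion
(Mathlib `ContMDiff.iff_comp_isImmersion`; Lee 2013, Cor. 5.30). [folklore] -/
theorem contMDiff_ι : ContMDiff (𝓡 n) (𝓡 n) ∞ F.ι := by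
  rw [ContMDiff.iff_comp_isImmersion
    (BoundaryManifold.isSmoothEmbedding_subtype_val (n := n) (W := F.cob.W)).isImmersion]
  exact ⟨F.continuous_ι, F.cob.isSmoothEmbedding_inr.contMDiff⟩

/-- **The collar of the sphere end**: `κ y t = D (inr y, t)`. [folklore] -/
def κ (y : 𝕊 n) (t : ℝ) : F.cob.W := F.collar.toFun (F.ι y) t

/-- `κ y 0 = inr y`. [folklore] -/
@[simp] theorem κ_zero (y : 𝕊 n) : F.κ y 0 = F.cob.inr y := by
  rw [κ, F.collar.apply_zero]; rfl

/-- `κ` is continuous on `𝕊ⁿ × [0, ∞)`. [folklore] -/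
theorem continuousOn_κ : ContinuousOn (uncurry F.κ) (univ ×ˢ Ici 0) :=
  F.collar.continuousOn_toFun.comp (F.continuous_ι.prodMap continuous_id).continuousOn
    fun _ hp => ⟨mem_univ _, hp.2⟩

/-- **`κ` is smooth on `𝕊ⁿ × [0, ∞)`** (the collar is, and `ι` is smooth). [folklore] -/
theorem contMDiffOn_κ :
    ContMDiffOn ((𝓡 n).prod 𝓘(ℝ, ℝ)) (𝓡∂ (n + 1)) ∞ (uncurry F.κ) (univ ×ˢ Ici 0) :=
  F.collar.contMDiffOn_toFun.comp (F.contMDiff_ι.prodMap contMDiff_id).contMDiffOn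
    fun _ hp => ⟨mem_univ _, hp.2⟩

/-- The injectivity relations of `κ` on `𝕊ⁿ × [0, ∞)`. [folklore] -/
theorem eq_of_κ_eq {y y' : 𝕊 n} {t t' : ℝ} (ht : 0 ≤ t) (ht' : 0 ≤ t') (h : F.κ y t = F.κ y' t') :
    y = y' ∧ t = t' := by
  obtain ⟨h1, h2⟩ := F.collar.eq_of_apply_eq ht ht' h
  exact ⟨F.injective_ι h1, h2⟩

/-- `κ y t`, `t ≥ 0`, lies in the collar region. [folklore] -/
theorem κ_mem_region (y : 𝕊 n) {t : ℝ} (ht : 0 ≤ t) : F.κ y t ∈ F.collar.region :=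
  F.collar.mem_region _ t ht

/-- `proj (κ y t) = ι y` for `t ≥ 0`. [folklore] -/
theorem proj_κ (y : 𝕊 n) {t : ℝ} (ht : 0 ≤ t) : F.collar.proj (F.κ y t) = F.ι y :=
  F.collar.proj_apply _ t ht

/-- `height (κ y t) = t` for `t ≥ 0`. [folklore] -/
theorem height_κ (y : 𝕊 n) {t : ℝ} (ht : 0 ≤ t) : F.collar.height (F.κ y t) = t :=
  F.collar.height_apply _ t ht

/-- `κ y t` with `t > 0` is not on the sphere end. [folklore] -/
theorem κ_not_mem_range_inr (y : 𝕊 n) {t : ℝ} (ht : 0 < t) : F.κ y t ∉ range F.cob.inr := by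
  rintro ⟨y', hy'⟩
  rw [← F.κ_zero] at hy'
  exact ht.ne' (F.eq_of_κ_eq ht.le le_rfl hy'.symm).2

/-- `κ y t` with `t > 0` is not on the `M`-end either (it is an interior point). [folklore] -/
theorem κ_not_mem_range_inl (y : 𝕊 n) {t : ℝ} (ht : 0 < t) : F.κ y t ∉ range F.cob.inl := by
  rintro ⟨x, hx⟩
  have hint := F.collar.isInteriorPoint_apply (F.ι y) ht
  have hbd : F.cob.inl x ∈ (𝓡∂ (n + 1)).boundary F.cob.W := F.cob.inl_mem_boundary x
  rw [hx] at hbd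
  exact ((𝓡∂ (n + 1)).isInteriorPoint_iff_not_isBoundaryPoint _).1 hint hbd

/-! ### The inverse of the sphere end and the sphere coordinate of the collar -/

attribute [local instance] Classical.propDecidable in
/-- A total inverse of the sphere end `inr : 𝕊ⁿ → W` (junk value `e₀` off its range). [folklore] -/
def inrInv (w : F.cob.W) : 𝕊 n :=
  if h : w ∈ range F.cob.inr then
    F.cob.isSmoothEmbedding_inr.isEmbedding.toHomeomorph.symm ⟨w, h⟩
  else pt₀

/-- `inrInv ∘ inr = id`. [folklore] -/
@[simp] theorem inrInv_inr (y : 𝕊 n) : F.inrInv (F.cob.inr y) = y := by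
  rw [inrInv, dif_pos (mem_range_self y)]
  exact F.cob.isSmoothEmbedding_inr.isEmbedding.toHomeomorph_symm_apply y

/-- `inr (inrInv w) = w` on the range of `inr`. [folklore] -/
theorem inr_inrInv {w : F.cob.W} (hw : w ∈ range F.cob.inr) : F.cob.inr (F.inrInv w) = w := by
  obtain ⟨y, rfl⟩ := hw
  rw [inrInv_inr]

/-- `inrInv` is continuous on the range of `inr`. [folklore] -/
theorem continuousOn_inrInv : ContinuousOn F.inrInv (range F.cob.inr) := by
  rw [continuousOn_iff_continuous_restrict]
  have h : (range F.cob.inr).restrict F.inrInv =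
      F.cob.isSmoothEmbedding_inr.isEmbedding.toHomeomorph.symm := by
    funext ⟨w, hw⟩
    simp only [restrict_apply, inrInv, dif_pos hw]
  rw [h]
  exact Homeomorph.continuous _

/-- The boundary projection of the collar, valued in the subtype `∂W`. [folklore] -/
def projB (z : F.cob.W) : (𝓡∂ (n + 1)).boundary F.cob.W := F.collar.proj z

/-- `projB` is `proj` (definitional). [folklore] -/
theorem projB_eq (z : F.cob.W) : F.projB z = F.collar.proj z := rfl

/-- `projB (κ y t) = ι y` for `t ≥ 0`. [folklore] -/
theorem projB_κ (y : 𝕊 n) {t : ℝ} (ht : 0 ≤ t) : F.projB (F.κ y t) = F.ι y := F.proj_κ y ht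

/-- **The sphere coordinate** of a point of the collar of the sphere end:
`projS (κ y t) = y`. [folklore] -/
def projS (z : F.cob.W) : 𝕊 n := F.inrInv (F.projB z : F.cob.W)

/-- `projS (κ y t) = y` for `t ≥ 0`. [folklore] -/
@[simp] theorem projS_κ (y : 𝕊 n) {t : ℝ} (ht : 0 ≤ t) : F.projS (F.κ y t) = y := by
  rw [projS, F.projB_κ y ht, coe_ι, inrInv_inr]

/-- **The collar region of the sphere end**: the points of the collar region whose boundary
projection lies on the sphere end, i.e. `κ (𝕊ⁿ × [0, ∞))`. [folklore] -/
def regionS : Set F.cob.W := {z | z ∈ F.collar.region ∧ (F.projB z : F.cob.W) ∈ range F.cob.inr}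

/-- `κ y t ∈ regionS` for `t ≥ 0`. [folklore] -/
theorem κ_mem_regionS (y : 𝕊 n) {t : ℝ} (ht : 0 ≤ t) : F.κ y t ∈ F.regionS :=
  ⟨F.κ_mem_region y ht, by rw [F.projB_κ y ht]; exact mem_range_self y⟩

/-- On `regionS`, `inr ∘ projS = val ∘ proj`. [folklore] -/
theorem inr_projS {z : F.cob.W} (hz : z ∈ F.regionS) :
    F.cob.inr (F.projS z) = (F.projB z : F.cob.W) :=
  F.inr_inrInv hz.2

/-- On `regionS`, `ι ∘ projS = proj`. [folklore] -/
theorem ι_projS {z : F.cob.W} (hz : z ∈ F.regionS) : F.ι (F.projS z) = F.projB z :=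
  Subtype.ext (F.inr_projS hz)

/-- **`κ` inverts `(projS, height)` on `regionS`.** [folklore] -/
theorem κ_projS_height {z : F.cob.W} (hz : z ∈ F.regionS) :
    F.κ (F.projS z) (F.collar.height z) = z := by
  rw [κ, F.ι_projS hz]
  exact F.collar.apply_proj_height z hz.1

/-- `regionS = κ (𝕊ⁿ × [0, ∞))`. [folklore] -/
theorem mem_regionS_iff {z : F.cob.W} : z ∈ F.regionS ↔ ∃ y t, 0 ≤ t ∧ F.κ y t = z :=
  ⟨fun hz => ⟨F.projS z, F.collar.height z, F.collar.height_nonneg z hz.1, F.κ_projS_height hz⟩,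
    fun ⟨y, _, ht, h⟩ => h ▸ F.κ_mem_regionS y ht⟩

/-- The height is nonnegative on `regionS`. [folklore] -/
theorem height_nonneg {z : F.cob.W} (hz : z ∈ F.regionS) : 0 ≤ F.collar.height z :=
  F.collar.height_nonneg z hz.1

/-- On `regionS`, the height vanishes exactly on the sphere end. [folklore] -/
theorem height_pos_iff {z : F.cob.W} (hz : z ∈ F.regionS) :
    0 < F.collar.height z ↔ z ∉ range F.cob.inr := by
  constructor
  · intro h hr
    rw [← F.κ_projS_height hz] at hr
    exact F.κ_not_mem_range_inr _ h hr
  · intro h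
    rcases (F.height_nonneg hz).lt_or_eq with h' | h'
    · exact h'
    · exfalso
      apply h
      rw [← F.κ_projS_height hz, ← h', κ_zero]
      exact mem_range_self _

/-! ### Continuity and smoothness of the sphere coordinate -/

/-- `projS` is continuous on `regionS`. [folklore] -/
theorem continuousOn_projS : ContinuousOn F.projS F.regionS :=
  F.continuousOn_inrInv.comp (continuous_subtype_val.comp_continuousOn
    (F.collar.continuousOn_proj.mono fun _ hz => hz.1)) fun _ hz => hz.2

variable [CompactSpace M]

/-- The range of the `M`-end is closed (`M` is compact). [folklore] -/
theorem isClosed_range_inl : IsClosed (range F.cob.inl) :=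
  (isCompact_range F.cob.continuous_inl).isClosed

omit [CompactSpace M] in
/-- The range of the sphere end is closed. [folklore] -/
theorem isClosed_range_inr : IsClosed (range F.cob.inr) :=
  (isCompact_range F.cob.continuous_inr).isClosed

/-- The part of `∂W` lying on the sphere end is open in `∂W` (its complement there is the compact
`M`-end). [folklore] -/
theorem isOpen_boundary_inter_range_inr :
    IsOpen {p : (𝓡∂ (n + 1)).boundary F.cob.W | (p : F.cob.W) ∈ range F.cob.inr} := by
  have h : {p : (𝓡∂ (n + 1)).boundary F.cob.W | (p : F.cob.W) ∈ range F.cob.inr} =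
      {p : (𝓡∂ (n + 1)).boundary F.cob.W | (p : F.cob.W) ∈ range F.cob.inl}ᶜ := by
    ext p
    simp only [mem_setOf_eq, mem_compl_iff]
    have hp : (p : F.cob.W) ∈ range F.cob.inl ∪ range F.cob.inr := by
      rw [F.cob.range_inl_union_range_inr]; exact p.2
    constructor
    · intro h1 h2
      exact Set.disjoint_left.1 F.cob.disjoint_range h2 h1
    · intro h1
      exact hp.resolve_left h1
  rw [h]
  exact (F.isClosed_range_inl.preimage continuous_subtype_val).isOpen_compl

/-- **`regionS` is open.** [folklore] -/
theorem isOpen_regionS : IsOpen F.regionS :=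
  F.collar.continuousOn_proj.isOpen_inter_preimage F.collar.isOpen_region
    F.isOpen_boundary_inter_range_inr

/-- `projS` is continuous at every point of `regionS`. [folklore] -/
theorem continuousAt_projS {z : F.cob.W} (hz : z ∈ F.regionS) : ContinuousAt F.projS z :=
  (F.continuousOn_projS z hz).continuousAt (F.isOpen_regionS.mem_nhds hz)

/-- **The sphere coordinate is smooth on `regionS`**: `inr ∘ projS = val ∘ proj` is smooth there
and `inr` is an immersion (Mathlib `ContMDiffAt.iff_comp_isImmersionAt`). [folklore] -/
theorem contMDiffAt_projS {z : F.cob.W} (hz : z ∈ F.regionS) :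
    ContMDiffAt (𝓡∂ (n + 1)) (𝓡 n) ∞ F.projS z := by
  rw [ContMDiffAt.iff_comp_isImmersionAt
    (F.cob.isSmoothEmbedding_inr.isImmersion.isImmersionAt (F.projS z))]
  refine ⟨F.continuousAt_projS hz, ?_⟩
  have h1 : ContMDiffOn (𝓡∂ (n + 1)) (𝓡∂ (n + 1)) ∞
      (fun z => ((F.projB z : (𝓡∂ (n + 1)).boundary F.cob.W) : F.cob.W)) F.collar.region :=
    (BoundaryManifold.isSmoothEmbedding_subtype_val (n := n) (W := F.cob.W)).contMDiff.comp_contMDiffOn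
      F.collar.contMDiffOn_proj
  have h2 : ContMDiffAt (𝓡∂ (n + 1)) (𝓡∂ (n + 1)) ∞
      (fun z => ((F.projB z : (𝓡∂ (n + 1)).boundary F.cob.W) : F.cob.W)) z :=
    (h1 z hz.1).contMDiffAt (F.collar.isOpen_region.mem_nhds hz.1)
  refine h2.congr_of_eventuallyEq ?_
  filter_upwards [F.isOpen_regionS.mem_nhds hz] with z' hz'
  exact F.inr_projS hz'

/-- The sphere coordinate is smooth on `regionS`. [folklore] -/
theorem contMDiffOn_projS : ContMDiffOn (𝓡∂ (n + 1)) (𝓡 n) ∞ F.projS F.regionS := fun _ hz =>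
  (F.contMDiffAt_projS hz).contMDiffWithinAt

/-! ### The two pieces -/

omit [CompactSpace M] in
/-- **The first piece** `A = W ∖ inr (𝕊ⁿ)`: the total space with the sphere end removed, an open
submanifold with boundary `inl (M)`. [cite: KervaireMilnorAnnals1963, Lemma 2.3, proof (p. 506)] -/
def A : TopologicalSpace.Opens F.cob.W := ⟨(range F.cob.inr)ᶜ, F.isClosed_range_inr.isOpen_compl⟩

omit [CompactSpace M] in
/-- Membership in the first piece. [folklore] -/
theorem mem_A_iff {w : F.cob.W} : w ∈ F.A ↔ w ∉ range F.cob.inr := Iff.rfl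

omit [CompactSpace M] in
/-- Collar points of positive height lie in the first piece. [folklore] -/
theorem κ_mem_A (y : 𝕊 n) {t : ℝ} (ht : 0 < t) : F.κ y t ∈ F.A := F.κ_not_mem_range_inr y ht

omit [CompactSpace M] in
/-- The point `κ (e₀, 1)` of the first piece, used as a junk value. [folklore] -/
def a₀ : F.A := ⟨F.κ pt₀ 1, F.κ_mem_A pt₀ one_pos⟩

omit [CompactSpace M] in
/-- A point of `A` lying in `regionS` has positive height. [folklore] -/
theorem height_pos_of_mem {a : F.A} (ha : (a : F.cob.W) ∈ F.regionS) : 0 < F.collar.height a :=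
  (F.height_pos_iff ha).2 a.2

end FillingData

namespace DiscFilling

/-- **The second piece** `B = ℝⁿ⁺¹`, re-charted on the half-space model `𝓡∂ (n + 1)` (no boundary;
tree synonym `HalfSpaceCharted`). [folklore] -/
abbrev B (n : ℕ) : Type := HalfSpaceCharted (𝔼 (n + 1))

variable {n : ℕ}

/-- The vector of a point of the second piece. [folklore] -/
def vec (b : B n) : 𝔼 (n + 1) := HalfSpaceCharted.of.symm b

/-- `vec (of x) = x` (definitional). [folklore] -/
@[simp] theorem vec_of (x : 𝔼 (n + 1)) : vec (HalfSpaceCharted.of x : B n) = x := rfl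

/-- `of (vec b) = b` (definitional). [folklore] -/
@[simp] theorem of_vec (b : B n) : (HalfSpaceCharted.of (vec b) : B n) = b := rfl

/-- `vec` is continuous (it is the inverse of the homeomorphism `ofHomeomorph`). [folklore] -/
theorem continuous_vec : Continuous (vec : B n → 𝔼 (n + 1)) :=
  (HalfSpaceCharted.ofHomeomorph (X := 𝔼 (n + 1))).symm.continuous

/-- `vec` is smooth. [folklore] -/
theorem contMDiff_vec : ContMDiff (𝓡∂ (n + 1)) 𝓘(ℝ, 𝔼 (n + 1)) ∞ (vec : B n → 𝔼 (n + 1)) :=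
  HalfSpaceCharted.contMDiff_of_symm (n := n) (X := 𝔼 (n + 1))

/-- `of : ℝⁿ⁺¹ → B` is smooth. [folklore] -/
theorem contMDiff_ofB :
    ContMDiff 𝓘(ℝ, 𝔼 (n + 1)) (𝓡∂ (n + 1)) ∞ (HalfSpaceCharted.of : 𝔼 (n + 1) → B n) :=
  HalfSpaceCharted.contMDiff_of (n := n) (X := 𝔼 (n + 1))

/-- The target `{1 < ‖x‖}` of the gluing map: the exterior of the closed unit ball. [folklore] -/
def glueTarget : Set (B n) := {b | 1 < ‖vec b‖}

/-- Membership in the target of the gluing map. [folklore] -/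
theorem mem_glueTarget_iff {b : B n} : b ∈ (glueTarget : Set (B n)) ↔ 1 < ‖vec b‖ := Iff.rfl

/-- The target of the gluing map is open. [folklore] -/
theorem isOpen_glueTarget : IsOpen (glueTarget : Set (B n)) :=
  isOpen_lt continuous_const (continuous_norm.comp continuous_vec)

/-- The compact piece `K_B = {‖x‖ ≤ 2}` of the second piece. [folklore] -/
def KB : Set (B n) := vec ⁻¹' closedBall (0 : 𝔼 (n + 1)) 2

/-- Membership in `K_B`. [folklore] -/
theorem mem_KB_iff {b : B n} : b ∈ (KB : Set (B n)) ↔ ‖vec b‖ ≤ 2 := by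
  simp [KB]

/-- `K_B` is compact. [folklore] -/
theorem isCompact_KB : IsCompact (KB : Set (B n)) :=
  (HalfSpaceCharted.ofHomeomorph (X := 𝔼 (n + 1))).symm.isCompact_preimage.2 (isCompact_closedBall _ _)

/-- The second piece has no boundary points. [folklore] -/
theorem not_isBoundaryPoint_B (b : B n) : ¬ (𝓡∂ (n + 1)).IsBoundaryPoint b := by
  intro h
  have : b ∈ (𝓡∂ (n + 1)).boundary (B n) := h
  rw [HalfSpaceCharted.boundary_eq_empty] at this
  exact this

/-- A vector of norm `> 1` is nonzero. [folklore] -/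
theorem ne_zero_of_one_lt_norm {x : 𝔼 (n + 1)} (hx : 1 < ‖x‖) : x ≠ 0 := by
  rintro rfl; rw [norm_zero] at hx; exact absurd hx (by norm_num)

/-- A vector of norm `≥ 1` is nonzero. [folklore] -/
theorem ne_zero_of_one_le_norm {x : 𝔼 (n + 1)} (hx : 1 ≤ ‖x‖) : x ≠ 0 := by
  rintro rfl; rw [norm_zero] at hx; exact absurd hx (by norm_num)

end DiscFilling

namespace FillingData

variable {n : ℕ} {M : Type} [TopologicalSpace M] [ChartedSpace (𝔼 n) M] (F : FillingData n M)

/-! ### The gluing map and its inverse -/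

/-- **The vector-valued gluing map** `κ (y, t) ↦ (1 + t) y` (meaningful on `regionS`). [folklore] -/
def glueVec (z : F.cob.W) : 𝔼 (n + 1) := (1 + F.collar.height z) • ((F.projS z : 𝕊 n) : 𝔼 (n + 1))

/-- `glueVec (κ y t) = (1 + t) y` for `t ≥ 0`. [folklore] -/
theorem glueVec_κ (y : 𝕊 n) {t : ℝ} (ht : 0 ≤ t) : F.glueVec (F.κ y t) = (1 + t) • (y : 𝔼 (n + 1)) := by
  rw [glueVec, F.height_κ y ht, F.projS_κ y ht]

/-- `‖glueVec z‖ = 1 + height z` on `regionS`. [folklore] -/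
theorem norm_glueVec {z : F.cob.W} (hz : z ∈ F.regionS) : ‖F.glueVec z‖ = 1 + F.collar.height z := by
  have h : 0 ≤ 1 + F.collar.height z := by linarith [F.height_nonneg hz]
  rw [glueVec, norm_smul, Real.norm_eq_abs, abs_of_nonneg h, norm_eq_of_mem_sphere, mul_one]

/-- The normalisation of `glueVec z` is the sphere coordinate. [folklore] -/
theorem sphN_glueVec {z : F.cob.W} (hz : z ∈ F.regionS) : sphN (F.glueVec z) = F.projS z := by
  have h : 0 < 1 + F.collar.height z := by linarith [F.height_nonneg hz]
  rw [glueVec, sphN_smul h (coe_sphere_ne_zero _), sphN_coe]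

/-- The source `{a | a ∈ regionS} = κ (𝕊ⁿ × (0, ∞))` of the gluing map. [folklore] -/
def glueSource : Set F.A := {a | (a : F.cob.W) ∈ F.regionS}

/-- Membership in the source of the gluing map. [folklore] -/
theorem mem_glueSource_iff {a : F.A} : a ∈ F.glueSource ↔ (a : F.cob.W) ∈ F.regionS := Iff.rfl

/-- **The gluing map** `A ⊇ κ (𝕊ⁿ × (0, ∞)) → B`, `κ (y, t) ↦ (1 + t) y` (the formula is total).
[folklore] -/
def glueFun (a : F.A) : B n := HalfSpaceCharted.of (F.glueVec a)

/-- The vector of the gluing map. [folklore] -/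
@[simp] theorem vec_glueFun (a : F.A) : vec (F.glueFun a) = F.glueVec a := rfl

/-- **The point `κ (x/‖x‖, ‖x‖ - 1) ∈ W`** of the inverse gluing map. [folklore] -/
def glueInvPt (x : 𝔼 (n + 1)) : F.cob.W := F.κ (sphN x) (‖x‖ - 1)

/-- For `‖x‖ > 1` the point of the inverse gluing map lies in the first piece. [folklore] -/
theorem glueInvPt_mem_A {x : 𝔼 (n + 1)} (hx : 1 < ‖x‖) : F.glueInvPt x ∈ F.A :=
  F.κ_mem_A _ (by linarith)

/-- For `‖x‖ ≥ 1` the point of the inverse gluing map lies in `regionS`. [folklore] -/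
theorem glueInvPt_mem_regionS {x : 𝔼 (n + 1)} (hx : 1 ≤ ‖x‖) : F.glueInvPt x ∈ F.regionS :=
  F.κ_mem_regionS _ (by linarith)

/-- The height of the point of the inverse gluing map is `‖x‖ - 1` (`‖x‖ ≥ 1`). [folklore] -/
theorem height_glueInvPt {x : 𝔼 (n + 1)} (hx : 1 ≤ ‖x‖) :
    F.collar.height (F.glueInvPt x) = ‖x‖ - 1 :=
  F.height_κ _ (by linarith)

attribute [local instance] Classical.propDecidable in
/-- **The inverse gluing map** `x ↦ κ (x/‖x‖, ‖x‖ - 1)` (junk value `a₀` off the target).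
[folklore] -/
def glueInv (b : B n) : F.A :=
  if hb : b ∈ (glueTarget : Set (B n)) then ⟨F.glueInvPt (vec b), F.glueInvPt_mem_A hb⟩ else F.a₀

/-- The point underlying the inverse gluing map on the target. [folklore] -/
theorem coe_glueInv_of_mem {b : B n} (hb : b ∈ (glueTarget : Set (B n))) :
    (F.glueInv b : F.cob.W) = F.glueInvPt (vec b) := by
  rw [glueInv, dif_pos hb]

/-- The gluing map sends its source into the target. [folklore] -/
theorem glueFun_mem_target {a : F.A} (ha : a ∈ F.glueSource) :
    F.glueFun a ∈ (glueTarget : Set (B n)) := by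
  rw [mem_glueTarget_iff, vec_glueFun, F.norm_glueVec ha]
  linarith [F.height_pos_of_mem ha]

/-- The inverse gluing map sends the target into the source. [folklore] -/
theorem glueInv_mem_source {b : B n} (hb : b ∈ (glueTarget : Set (B n))) :
    F.glueInv b ∈ F.glueSource := by
  rw [mem_glueSource_iff, F.coe_glueInv_of_mem hb]
  exact F.glueInvPt_mem_regionS (le_of_lt hb)

/-- `glueInvPt ∘ glueVec = id` on `regionS`. [folklore] -/
theorem glueInvPt_glueVec {z : F.cob.W} (hz : z ∈ F.regionS) : F.glueInvPt (F.glueVec z) = z := by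
  rw [glueInvPt, F.sphN_glueVec hz, F.norm_glueVec hz, add_sub_cancel_left, F.κ_projS_height hz]

/-- `glueVec ∘ glueInvPt = id` on `{1 ≤ ‖x‖}`. [folklore] -/
theorem glueVec_glueInvPt {x : 𝔼 (n + 1)} (hx : 1 ≤ ‖x‖) : F.glueVec (F.glueInvPt x) = x := by
  rw [glueInvPt, F.glueVec_κ _ (by linarith), add_sub_cancel, norm_smul_coe_sphN (ne_zero_of_one_le_norm hx)]

/-- `glueInv ∘ glueFun = id` on the source. [folklore] -/
theorem glueInv_glueFun {a : F.A} (ha : a ∈ F.glueSource) : F.glueInv (F.glueFun a) = a := by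
  apply Subtype.ext
  rw [F.coe_glueInv_of_mem (F.glueFun_mem_target ha), vec_glueFun, F.glueInvPt_glueVec ha]

/-- `glueFun ∘ glueInv = id` on the target. [folklore] -/
theorem glueFun_glueInv {b : B n} (hb : b ∈ (glueTarget : Set (B n))) : F.glueFun (F.glueInv b) = b := by
  show HalfSpaceCharted.of (F.glueVec (F.glueInv b : F.cob.W)) = b
  rw [F.coe_glueInv_of_mem hb, F.glueVec_glueInvPt (le_of_lt hb), of_vec]

/-! #### Continuity -/

/-- `glueVec` is continuous on `regionS`. [folklore] -/
theorem continuousOn_glueVec : ContinuousOn F.glueVec F.regionS :=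
  (continuousOn_const.add (F.collar.continuousOn_height.mono fun _ hz => hz.1)).smul
    (continuous_subtype_val.comp_continuousOn F.continuousOn_projS)

variable [CompactSpace M]

/-- The source of the gluing map is open. [folklore] -/
theorem isOpen_glueSource : IsOpen F.glueSource := F.isOpen_regionS.preimage continuous_subtype_val

omit [CompactSpace M] in
/-- The gluing map is continuous on its source. [folklore] -/
theorem continuousOn_glueFun : ContinuousOn F.glueFun F.glueSource :=
  (HalfSpaceCharted.ofHomeomorph (X := 𝔼 (n + 1))).continuous.comp_continuousOn
    (F.continuousOn_glueVec.comp continuous_subtype_val.continuousOn fun _ ha => ha)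

omit [CompactSpace M] in
/-- The point of the inverse gluing map is continuous on `{1 ≤ ‖x‖}`. [folklore] -/
theorem continuousOn_glueInvPt : ContinuousOn F.glueInvPt {x : 𝔼 (n + 1) | 1 ≤ ‖x‖} := by
  have h1 : ContinuousOn (fun x : 𝔼 (n + 1) => (sphN x, ‖x‖ - 1)) {x | 1 ≤ ‖x‖} :=
    (continuousOn_sphN.mono fun x hx => ne_zero_of_one_le_norm hx).prodMk
      (continuous_norm.sub continuous_const).continuousOn
  exact F.continuousOn_κ.comp h1 fun x hx => ⟨mem_univ _, by simp only [mem_Ici]; linarith [hx.out]⟩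

omit [CompactSpace M] in
/-- The inverse gluing map is continuous on the target. [folklore] -/
theorem continuousOn_glueInv : ContinuousOn F.glueInv (glueTarget : Set (B n)) := by
  rw [Topology.IsInducing.subtypeVal.continuousOn_iff]
  have h : ContinuousOn (fun b : B n => F.glueInvPt (vec b)) (glueTarget : Set (B n)) :=
    F.continuousOn_glueInvPt.comp continuous_vec.continuousOn fun b hb =>
      show 1 ≤ ‖vec b‖ from le_of_lt hb
  exact h.congr fun b hb => F.coe_glueInv_of_mem hb

/-- **The gluing map as an open partial homeomorphism** `A ⊇ κ (𝕊ⁿ × (0, ∞)) ≅ {1 < ‖x‖} ⊆ B`.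
[folklore] -/
def glue : OpenPartialHomeomorph F.A (B n) where
  toFun := F.glueFun
  invFun := F.glueInv
  source := F.glueSource
  target := glueTarget
  map_source' _ ha := F.glueFun_mem_target ha
  map_target' _ hb := F.glueInv_mem_source hb
  left_inv' _ ha := F.glueInv_glueFun ha
  right_inv' _ hb := F.glueFun_glueInv hb
  open_source := F.isOpen_glueSource
  open_target := isOpen_glueTarget
  continuousOn_toFun := F.continuousOn_glueFun
  continuousOn_invFun := F.continuousOn_glueInv

/-- The source of the gluing map (definitional). [folklore] -/
@[simp] theorem glue_source : F.glue.source = F.glueSource := rfl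

/-- The target of the gluing map (definitional). [folklore] -/
@[simp] theorem glue_target : F.glue.target = glueTarget := rfl

/-- The gluing map as a function (definitional). [folklore] -/
theorem glue_apply (a : F.A) : F.glue a = F.glueFun a := rfl

/-- The inverse gluing map as a function (definitional). [folklore] -/
theorem glue_symm_apply (b : B n) : F.glue.symm b = F.glueInv b := rfl

/-! #### Smoothness of the gluing map and of its inverse -/

open scoped EuclideanSpace in
/-- `glueVec` is smooth on `regionS` (height and sphere coordinate are). [folklore] -/
theorem contMDiffOn_glueVec : ContMDiffOn (𝓡∂ (n + 1)) 𝓘(ℝ, 𝔼 (n + 1)) ∞ F.glueVec F.regionS :=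
  (contMDiffOn_const.add (F.collar.contMDiffOn_height.mono fun _ hz => hz.1)).smul
    ((contMDiff_coe_sphere (E := 𝔼 (n + 1)) (n := n)).comp_contMDiffOn F.contMDiffOn_projS)

/-- **The gluing map is smooth** on its source (`of : ℝⁿ⁺¹ → B` is smooth). [folklore] -/
theorem contMDiffOn_glue : ContMDiffOn (𝓡∂ (n + 1)) (𝓡∂ (n + 1)) ∞ F.glue F.glue.source :=
  contMDiff_ofB.comp_contMDiffOn
    (F.contMDiffOn_glueVec.comp contMDiff_subtype_val.contMDiffOn fun _ ha => ha)

omit [CompactSpace M] in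
/-- The point of the inverse gluing map is smooth on `{1 < ‖x‖}`. [folklore] -/
theorem contMDiffOn_glueInvPt :
    ContMDiffOn 𝓘(ℝ, 𝔼 (n + 1)) (𝓡∂ (n + 1)) ∞ F.glueInvPt {x : 𝔼 (n + 1) | 1 < ‖x‖} := by
  have hnorm : ContMDiffOn 𝓘(ℝ, 𝔼 (n + 1)) 𝓘(ℝ, ℝ) ∞ (fun x : 𝔼 (n + 1) => ‖x‖ - 1)
      {x | 1 < ‖x‖} := fun x hx =>
    ((contDiffAt_norm ℝ (ne_zero_of_one_lt_norm hx)).sub contDiffAt_const).contMDiffAt.contMDiffWithinAt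
  have h1 : ContMDiffOn 𝓘(ℝ, 𝔼 (n + 1)) ((𝓡 n).prod 𝓘(ℝ, ℝ)) ∞
      (fun x : 𝔼 (n + 1) => (sphN x, ‖x‖ - 1)) {x | 1 < ‖x‖} :=
    (contMDiffOn_sphN.mono fun x hx => ne_zero_of_one_lt_norm hx).prodMk hnorm
  exact F.contMDiffOn_κ.comp h1 fun x hx => ⟨mem_univ _, by simp only [mem_Ici]; linarith [hx.out]⟩

/-- **The inverse gluing map is smooth** on the target. [folklore] -/
theorem contMDiffOn_glue_symm : ContMDiffOn (𝓡∂ (n + 1)) (𝓡∂ (n + 1)) ∞ F.glue.symm F.glue.target := by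
  intro b hb
  rw [glue_target] at hb
  have hpt : ContMDiffAt (𝓡∂ (n + 1)) (𝓡∂ (n + 1)) ∞ (fun b : B n => F.glueInvPt (vec b)) b :=
    ((F.contMDiffOn_glueInvPt _ hb).contMDiffAt ((isOpen_lt continuous_const continuous_norm).mem_nhds hb)).comp
      b (contMDiff_vec b)
  have h : ContMDiffAt (𝓡∂ (n + 1)) (𝓡∂ (n + 1)) ∞ (Subtype.val ∘ F.glueInv) b := by
    refine hpt.congr_of_eventuallyEq
      (Filter.eventuallyEq_of_mem (isOpen_glueTarget.mem_nhds hb) fun b' hb' => ?_)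
    exact F.coe_glueInv_of_mem hb'
  rw [ContMDiffAt.subtypeVal_comp_iff] at h
  exact h.contMDiffWithinAt

/-! ### The gluing datum and the capped manifold -/

/-- **The gluing datum of the disc filling**: `A = W ∖ inr (𝕊ⁿ)` and `B = ℝⁿ⁺¹` glued along
`κ (y, t) ↦ (1 + t) y`. [cite: KervaireMilnorAnnals1963, Lemma 2.3, proof (p. 506)] -/
def glueData : SmoothGlueData (𝓡∂ (n + 1)) (𝓡∂ (n + 1)) F.A (B n) (𝔼 (n + 1)) :=
  ⟨F.glue, F.contMDiffOn_glue, F.contMDiffOn_glue_symm, ContinuousLinearEquiv.refl ℝ _,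
    ContinuousLinearEquiv.refl ℝ _⟩

/-- The gluing map of the gluing datum is `glue` (definitional). [folklore] -/
@[simp] theorem glueData_glue : F.glueData.glue = F.glue := rfl

/-- **The capped manifold `V = W ∪_{𝕊ⁿ} 𝔻ⁿ⁺¹`** ("filling in a disk `Dⁿ⁺¹` we obtain a manifold
`W'` with `bW' = M`", Kervaire–Milnor 1963, p. 506), as the glued `C^∞` manifold with boundary
`A ∪_glue B`. [cite: KervaireMilnorAnnals1963, Lemma 2.3, proof (p. 506)] -/
abbrev V : Type := F.glueData.Glued

/-! ### Separation, compactness, countability -/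

/-- The graph of the gluing map is `{(a, x) : 1 ≤ ‖x‖, a = κ (x/‖x‖, ‖x‖ - 1)}` (for `a ∈ A` the
value `‖x‖ = 1` does not occur, the point `κ (y, 0) = inr y` being removed). [folklore] -/
theorem graph_glue_eq :
    {p : F.A × B n | p.1 ∈ F.glue.source ∧ F.glue p.1 = p.2} =
      {p : F.A × B n | 1 ≤ ‖vec p.2‖} ∩
        (fun p : F.A × B n => ((p.1 : F.cob.W), F.glueInvPt (vec p.2))) ⁻¹' diagonal F.cob.W := by
  ext ⟨a, b⟩
  simp only [mem_setOf_eq, glue_source, glue_apply, mem_inter_iff, mem_preimage, mem_diagonal_iff]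
  constructor
  · rintro ⟨ha, rfl⟩
    refine ⟨?_, ?_⟩
    · rw [vec_glueFun, F.norm_glueVec ha]; linarith [F.height_nonneg ha]
    · rw [vec_glueFun, F.glueInvPt_glueVec ha]
  · rintro ⟨h1, h2⟩
    have hb : b ∈ (glueTarget : Set (B n)) := by
      rcases h1.lt_or_eq with h | h
      · exact h
      · exfalso
        apply a.2
        rw [h2, glueInvPt, ← h, sub_self, κ_zero]
        exact mem_range_self _
    have ha : a = F.glueInv b := Subtype.ext (by rw [h2, F.coe_glueInv_of_mem hb])
    refine ⟨ha ▸ F.glueInv_mem_source hb, ?_⟩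
    rw [ha, F.glueFun_glueInv hb]

/-- The graph of the gluing map is closed. [folklore] -/
theorem isClosed_graph_glue : IsClosed {p : F.A × B n | p.1 ∈ F.glue.source ∧ F.glue p.1 = p.2} := by
  rw [F.graph_glue_eq]
  have hC : IsClosed {p : F.A × B n | 1 ≤ ‖vec p.2‖} :=
    isClosed_le continuous_const (continuous_norm.comp (continuous_vec.comp continuous_snd))
  refine ContinuousOn.preimage_isClosed_of_isClosed ?_ hC isClosed_diagonal
  exact (continuous_subtype_val.comp continuous_fst).continuousOn.prodMk
    (F.continuousOn_glueInvPt.comp (continuous_vec.comp continuous_snd).continuousOn fun p hp => hp)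

/-- **`V` is Hausdorff.** [folklore] -/
instance t2Space_V : T2Space F.V := F.glueData.t2Space_of_isClosed_graph F.isClosed_graph_glue

omit [CompactSpace M] in
/-- The thin open collar `{z ∈ regionS | height z < 1} = κ (𝕊ⁿ × [0, 1))` of the sphere end. [folklore] -/
def thinCollar : Set F.cob.W := F.regionS ∩ F.collar.height ⁻¹' Iio 1

/-- The thin open collar is open. [folklore] -/
theorem isOpen_thinCollar : IsOpen F.thinCollar :=
  (F.collar.continuousOn_height.mono fun _ hz => hz.1).isOpen_inter_preimage F.isOpen_regionS isOpen_Iio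

omit [CompactSpace M] in
/-- The sphere end lies in the thin open collar. [folklore] -/
theorem range_inr_subset_thinCollar : range F.cob.inr ⊆ F.thinCollar := by
  rintro _ ⟨y, rfl⟩
  refine ⟨by rw [← F.κ_zero]; exact F.κ_mem_regionS y le_rfl, ?_⟩
  show F.collar.height (F.cob.inr y) < 1
  rw [← F.κ_zero, F.height_κ y le_rfl]; exact one_pos

omit [CompactSpace M] in
/-- The compact piece `K_A = W ∖ κ (𝕊ⁿ × [0, 1))` of the first piece. [folklore] -/
def KA : Set F.A := {a | (a : F.cob.W) ∉ F.thinCollar}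

/-- `K_A` is compact (`W` is compact). [folklore] -/
theorem isCompact_KA : IsCompact F.KA := by
  have himg : (Subtype.val : F.A → F.cob.W) '' F.KA = F.thinCollarᶜ := by
    ext w
    simp only [mem_image, mem_compl_iff, KA, mem_setOf_eq]
    constructor
    · rintro ⟨a, ha, rfl⟩; exact ha
    · intro hw
      exact ⟨⟨w, fun h => hw (F.range_inr_subset_thinCollar h)⟩, hw, rfl⟩
  rw [Topology.IsInducing.subtypeVal.isCompact_iff]
  convert F.isOpen_thinCollar.isClosed_compl.isCompact using 1
  exact himg

/-- **`V` is compact**: it is covered by the images of `K_A` and `K_B`. [folklore] -/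
instance compactSpace_V : CompactSpace F.V := by
  refine F.glueData.compactSpace_of_forall_not_mem F.isCompact_KA isCompact_KB ?_ ?_
  · intro a ha
    simp only [KA, mem_setOf_eq, not_not] at ha
    have has : a ∈ F.glueSource := ha.1
    refine ⟨has, ?_⟩
    show F.glueFun a ∈ KB
    rw [mem_KB_iff, vec_glueFun, F.norm_glueVec ha.1]
    have := ha.2
    simp only [mem_preimage, mem_Iio] at this
    linarith
  · intro b hb
    rw [mem_KB_iff, not_le] at hb
    have hbt : b ∈ (glueTarget : Set (B n)) := by
      rw [mem_glueTarget_iff]; linarith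
    refine ⟨hbt, ?_⟩
    show (F.glueInv b : F.cob.W) ∉ F.thinCollar
    rw [F.coe_glueInv_of_mem hbt]
    rintro ⟨-, h2⟩
    simp only [mem_preimage, mem_Iio, F.height_glueInvPt (le_of_lt hbt)] at h2
    linarith

/-- `V` is second countable. [folklore] -/
instance secondCountableTopology_V : SecondCountableTopology F.V :=
  F.glueData.secondCountableTopologyH

/-! ### The boundary of `V` and the null-cobordism `M = ∂V` -/

omit [CompactSpace M] in
/-- A point of the first piece is a boundary point of `A` iff it lies on the `M`-end of `W`. [folklore] -/
theorem isBoundaryPoint_A_iff (a : F.A) :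
    (𝓡∂ (n + 1)).IsBoundaryPoint a ↔ (a : F.cob.W) ∈ range F.cob.inl := by
  rw [(𝓡∂ (n + 1)).isBoundaryPoint_iff_isBoundaryPoint_val]
  change (a : F.cob.W) ∈ (𝓡∂ (n + 1)).boundary F.cob.W ↔ _
  rw [← F.cob.range_inl_union_range_inr]
  exact ⟨fun h => h.resolve_right a.2, fun h => Or.inl h⟩

/-- **The boundary of `V` is the `M`-end**: `∂V = inl (A ∩ inl (M))` ("`bW' = M`", Kervaire–Milnor
1963, p. 506). [cite: KervaireMilnorAnnals1963, Lemma 2.3, proof (p. 506)] -/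
theorem boundary_V_eq :
    (𝓡∂ (n + 1)).boundary F.V = F.glueData.inl '' {a : F.A | (a : F.cob.W) ∈ range F.cob.inl} := by
  have hA : (𝓡∂ (n + 1)).boundary F.A = {a : F.A | (a : F.cob.W) ∈ range F.cob.inl} :=
    Set.ext fun a => F.isBoundaryPoint_A_iff a
  have hB : (𝓡∂ (n + 1)).boundary (B n) = ∅ := Set.ext fun b =>
    ⟨fun h => not_isBoundaryPoint_B b h, fun h => h.elim⟩
  rw [F.glueData.boundary_glued_eq, hA, hB, image_empty, union_empty]

omit [CompactSpace M] in
/-- The `M`-end misses the sphere end. [folklore] -/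
theorem inl_mem_A (x : M) : F.cob.inl x ∈ F.A := fun h =>
  Set.disjoint_left.1 F.cob.disjoint_range (mem_range_self x) h

omit [CompactSpace M] in
/-- The `M`-end as a map into the first piece. [folklore] -/
def inclA (x : M) : F.A := ⟨F.cob.inl x, F.inl_mem_A x⟩

omit [CompactSpace M] in
/-- The underlying point of `inclA x` is `inl x` (definitional). [folklore] -/
@[simp] theorem coe_inclA (x : M) : (F.inclA x : F.cob.W) = F.cob.inl x := rfl

omit [CompactSpace M] in
/-- `inclA` is a smooth embedding (corestriction of the end embedding to the open subset `A`,
`Manifold.IsSmoothEmbedding.codRestrict_opens`). [folklore] -/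
theorem isSmoothEmbedding_inclA [IsManifold (𝓡 n) ∞ M] :
    Manifold.IsSmoothEmbedding (𝓡 n) (𝓡∂ (n + 1)) ∞ F.inclA :=
  F.cob.isSmoothEmbedding_inl.codRestrict_opens F.A F.inl_mem_A

omit [CompactSpace M] in
/-- `inclA x` is not in the source of the gluing map. [folklore] -/
theorem inclA_not_mem_glueSource (x : M) : F.inclA x ∉ F.glueSource := fun h => by
  have h' : F.cob.inl x ∈ F.regionS := h
  have hpos : 0 < F.collar.height (F.cob.inl x) := (F.height_pos_iff h').2 (F.inl_mem_A x)
  have hmem : F.κ (F.projS (F.cob.inl x)) (F.collar.height (F.cob.inl x)) ∈ range F.cob.inl := by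
    rw [F.κ_projS_height h']; exact mem_range_self x
  exact F.κ_not_mem_range_inl _ hpos hmem

/-- **The boundary inclusion `M → V`** of the capped manifold: `M ⊆ A ⊆ V`. [cite: KervaireMilnorAnnals1963, Lemma 2.3, proof (p. 506)] -/
def incl (x : M) : F.V := F.glueData.inl (F.inclA x)

/-- `incl = inl ∘ inclA` (definitional). [folklore] -/
theorem incl_apply (x : M) : F.incl x = F.glueData.inl (F.inclA x) := rfl

/-- The boundary inclusion is a smooth embedding. [folklore] -/
theorem isSmoothEmbedding_incl [IsManifold (𝓡 n) ∞ M] :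
    Manifold.IsSmoothEmbedding (𝓡 n) (𝓡∂ (n + 1)) ∞ F.incl :=
  F.glueData.isSmoothEmbedding_inl_compH F.isSmoothEmbedding_inclA

/-- **The boundary inclusion is onto `∂V`.** [cite: KervaireMilnorAnnals1963, Lemma 2.3, proof (p. 506)] -/
theorem range_incl : range F.incl = (𝓡∂ (n + 1)).boundary F.V := by
  rw [F.boundary_V_eq]
  ext p
  constructor
  · rintro ⟨x, rfl⟩
    exact ⟨F.inclA x, mem_range_self x, rfl⟩
  · rintro ⟨a, ⟨x, hx⟩, rfl⟩
    refine ⟨x, ?_⟩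
    rw [incl_apply]
    congr 1
    exact Subtype.ext hx

/-- **The null-cobordism `M = ∂V` obtained by filling in the disc** ("filling in a disk `Dⁿ⁺¹` we
obtain a manifold `W'` with `bW' = M`", Kervaire–Milnor 1963, proof of Lemma 2.3, p. 506).
[cite: KervaireMilnorAnnals1963, Lemma 2.3, proof (p. 506)] -/
def nullCobordism [IsManifold (𝓡 n) ∞ M] : NullCobordism n M where
  W := F.V
  incl := F.incl
  isSmoothEmbedding_incl := F.isSmoothEmbedding_incl
  range_incl := F.range_incl

/-- The total space of the null-cobordism is `V` (definitional). [folklore] -/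
theorem nullCobordism_W [IsManifold (𝓡 n) ∞ M] : F.nullCobordism.W = F.V := rfl

/-- The boundary inclusion of the null-cobordism is `incl` (definitional). [folklore] -/
theorem nullCobordism_incl [IsManifold (𝓡 n) ∞ M] (x : M) : F.nullCobordism.incl x = F.incl x := rfl

/-! ### `V` as `W` with a disc filled in: the second piece and the embedding of `W` -/

/-- **The second piece `ℝⁿ⁺¹ → V`** (its closed unit ball is the disc filled in). [folklore] -/
def inrE (x : 𝔼 (n + 1)) : F.V := F.glueData.inr (HalfSpaceCharted.of x)

/-- `inrE x = inr (of x)` (definitional). [folklore] -/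
theorem inrE_apply (x : 𝔼 (n + 1)) : F.inrE x = F.glueData.inr (HalfSpaceCharted.of x) := rfl

/-- `inr b = inrE (vec b)`. [folklore] -/
theorem inr_eq_inrE (b : B n) : F.glueData.inr b = F.inrE (vec b) := rfl

/-- `inrE` is an open embedding. [folklore] -/
theorem isOpenEmbedding_inrE : Topology.IsOpenEmbedding F.inrE :=
  F.glueData.isOpenEmbedding_inr.comp
    (HalfSpaceCharted.ofHomeomorph (X := 𝔼 (n + 1))).isOpenEmbedding

/-- `inrE` is continuous. [folklore] -/
theorem continuous_inrE : Continuous F.inrE := F.isOpenEmbedding_inrE.continuous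

/-- `inrE` is injective. [folklore] -/
theorem injective_inrE : Injective F.inrE := F.isOpenEmbedding_inrE.injective

/-- `inrE x` lies in the image of a set iff `x` lies in the set. [folklore] -/
theorem inrE_mem_image_iff {x : 𝔼 (n + 1)} {s : Set (𝔼 (n + 1))} : F.inrE x ∈ F.inrE '' s ↔ x ∈ s :=
  F.injective_inrE.mem_set_image

/-- **The gluing relation**: `inl ⟨z, _⟩ = inrE (glueVec z)` for `z` in the open collar of the sphere
end, i.e. `inl (κ (y, t)) = inrE ((1 + t) y)` for `t > 0`. [folklore] -/
theorem inl_eq_inrE {a : F.A} (ha : (a : F.cob.W) ∈ F.regionS) :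
    F.glueData.inl a = F.inrE (F.glueVec a) := by
  have has : a ∈ F.glueData.glue.source := ha
  rw [← F.glueData.inr_glue has]
  rfl

/-- `inl a = inrE x` forces `a` to lie in the open collar and `x = glueVec a`. [folklore] -/
theorem inl_eq_inrE_iff {a : F.A} {x : 𝔼 (n + 1)} :
    F.glueData.inl a = F.inrE x ↔ (a : F.cob.W) ∈ F.regionS ∧ F.glueVec a = x := by
  rw [inrE_apply, F.glueData.inl_eq_inr_iff]
  exact Iff.rfl

/-- Every point of `V` is `inl a` or `inrE x`. [folklore] -/
theorem exists_inl_or_inrE (p : F.V) : (∃ a, F.glueData.inl a = p) ∨ ∃ x, F.inrE x = p := by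
  rcases F.glueData.exists_inl_or_inr p with h | ⟨b, rfl⟩
  · exact Or.inl h
  · exact Or.inr ⟨vec b, rfl⟩

attribute [local instance] Classical.propDecidable in
/-- **The embedding `W → V`**: `inl` on `W ∖ inr (𝕊ⁿ)`, and the unit sphere of the second piece on
the sphere end (`inr y ↦ inrE y`). [cite: KervaireMilnorAnnals1963, Lemma 2.3, proof (p. 506)] -/
def embW (w : F.cob.W) : F.V :=
  if h : w ∈ range F.cob.inr then F.inrE (F.inrInv w : 𝔼 (n + 1)) else F.glueData.inl ⟨w, h⟩

/-- On the sphere end the embedding is the unit sphere of the second piece. [folklore] -/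
@[simp] theorem embW_inr (y : 𝕊 n) : F.embW (F.cob.inr y) = F.inrE y := by
  rw [embW, dif_pos (mem_range_self y), inrInv_inr]

/-- Off the sphere end the embedding is `inl`. [folklore] -/
theorem embW_of_not_mem {w : F.cob.W} (hw : w ∉ range F.cob.inr) :
    F.embW w = F.glueData.inl ⟨w, hw⟩ := by
  rw [embW, dif_neg hw]

/-- On the first piece the embedding is `inl`. [folklore] -/
theorem embW_coe (a : F.A) : F.embW a = F.glueData.inl a := F.embW_of_not_mem a.2

/-- **On the collar of the sphere end the embedding is `inrE ∘ glueVec`** (including the sphere end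
itself, where `glueVec (inr y) = y`). [folklore] -/
theorem embW_of_mem_regionS {z : F.cob.W} (hz : z ∈ F.regionS) : F.embW z = F.inrE (F.glueVec z) := by
  by_cases h : z ∈ range F.cob.inr
  · obtain ⟨y, rfl⟩ := h
    rw [embW_inr, ← F.κ_zero, F.glueVec_κ y le_rfl, add_zero, one_smul]
  · rw [F.embW_of_not_mem h]
    exact F.inl_eq_inrE hz

/-- **The embedding `W → V` is continuous**: it is `inrE ∘ glueVec` on the open collar region of
the sphere end and `inl` on the open first piece. [folklore] -/
theorem continuous_embW : Continuous F.embW := by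
  rw [continuous_iff_continuousAt]
  intro w
  by_cases hw : w ∈ F.regionS
  · have h1 : ContinuousOn (fun z => F.inrE (F.glueVec z)) F.regionS :=
      F.continuous_inrE.comp_continuousOn F.continuousOn_glueVec
    have h2 : F.embW =ᶠ[𝓝 w] fun z => F.inrE (F.glueVec z) :=
      Filter.eventuallyEq_of_mem (F.isOpen_regionS.mem_nhds hw) fun z hz => F.embW_of_mem_regionS hz
    exact ((h1 w hw).continuousAt (F.isOpen_regionS.mem_nhds hw)).congr h2.symm
  · have hwA : w ∈ F.A := fun h => hw (by
      obtain ⟨y, rfl⟩ := h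
      rw [← F.κ_zero]; exact F.κ_mem_regionS y le_rfl)
    have h1 : ContinuousOn F.embW (F.A : Set F.cob.W) := by
      rw [continuousOn_iff_continuous_restrict]
      have heq : (F.A : Set F.cob.W).restrict F.embW = fun a => F.glueData.inl a :=
        funext fun a => F.embW_coe a
      rw [heq]
      exact F.glueData.continuous_inl
    exact h1.continuousAt (F.A.isOpen.mem_nhds hwA)

/-- **The embedding `W → V` is injective.** [folklore] -/
theorem injective_embW : Injective F.embW := by
  intro w w' h
  by_cases hw : w ∈ range F.cob.inr <;> by_cases hw' : w' ∈ range F.cob.inr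
  · obtain ⟨y, rfl⟩ := hw
    obtain ⟨y', rfl⟩ := hw'
    rw [embW_inr, embW_inr] at h
    rw [Subtype.ext (F.injective_inrE h)]
  · obtain ⟨y, rfl⟩ := hw
    rw [embW_inr, F.embW_of_not_mem hw', eq_comm, inl_eq_inrE_iff] at h
    have := F.norm_glueVec h.1
    rw [h.2, norm_eq_of_mem_sphere] at this
    linarith [F.height_pos_of_mem (a := ⟨w', hw'⟩) h.1]
  · obtain ⟨y', rfl⟩ := hw'
    rw [embW_inr, F.embW_of_not_mem hw, inl_eq_inrE_iff] at h
    have := F.norm_glueVec h.1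
    rw [h.2, norm_eq_of_mem_sphere] at this
    linarith [F.height_pos_of_mem (a := ⟨w, hw⟩) h.1]
  · rw [F.embW_of_not_mem hw, F.embW_of_not_mem hw'] at h
    exact congrArg Subtype.val (F.glueData.inl_injective h)

/-- **The range of the embedding `W → V` is the complement of the open unit ball of the second
piece** (`V = W ∪ 𝔻ⁿ⁺¹`, `W ∩ 𝔻ⁿ⁺¹ = 𝕊ⁿ`). [cite: KervaireMilnorAnnals1963, Lemma 2.3, proof (p. 506)] -/
theorem range_embW : range F.embW = (F.inrE '' ball (0 : 𝔼 (n + 1)) 1)ᶜ := by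
  ext p
  simp only [mem_range, mem_compl_iff]
  constructor
  · rintro ⟨w, rfl⟩ hp
    by_cases hw : w ∈ range F.cob.inr
    · obtain ⟨y, rfl⟩ := hw
      rw [embW_inr, inrE_mem_image_iff, mem_ball_zero_iff, norm_eq_of_mem_sphere] at hp
      exact lt_irrefl _ hp
    · rw [F.embW_of_not_mem hw] at hp
      obtain ⟨x, hx, hx'⟩ := hp
      rw [eq_comm, inl_eq_inrE_iff] at hx'
      have h1 := F.norm_glueVec hx'.1
      rw [hx'.2] at h1
      rw [mem_ball_zero_iff] at hx
      linarith [F.height_pos_of_mem (a := ⟨w, hw⟩) hx'.1]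
  · intro hp
    rcases F.exists_inl_or_inrE p with ⟨a, rfl⟩ | ⟨x, rfl⟩
    · exact ⟨a, F.embW_coe a⟩
    · rw [inrE_mem_image_iff, mem_ball_zero_iff, not_lt] at hp
      rcases hp.lt_or_eq with h | h
      · refine ⟨F.glueInvPt x, ?_⟩
        rw [F.embW_of_mem_regionS (F.glueInvPt_mem_regionS hp), F.glueVec_glueInvPt hp]
      · refine ⟨F.cob.inr ⟨x, mem_sphere_zero_iff_norm.2 h.symm⟩, ?_⟩
        rw [embW_inr]

/-- The embedding `W → V` is a closed embedding (`W` is compact, `V` is Hausdorff). [folklore] -/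
theorem isClosedEmbedding_embW : Topology.IsClosedEmbedding F.embW :=
  F.continuous_embW.isClosedEmbedding F.injective_embW

end FillingData

end Literature.Topology.FourManifolds
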